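import Summits.FinalStateConjecture.FinalStateConjecture.Theorems.SignedCensusStaticAnchor

/-!
# Birth skeleton (BC3) for crux `StaticAnchor` (stmt-FinalStateConjecture-10827),
# route `SignedCensus` — "the static anchor through the printed non-rotating uniqueness theorem:
# two regularity bridges, then Sudarsky–Wald and Chruściel–Galloway"

planner-skel-stmt-FinalStateConjecture-10827-0 (skeleton registrar, route re-audit bin REPAIRABLE),
2026-08-17. Target: the route decl
`Summit.FinalStateConjecture.FinalStateConjecture.Theses.SignedCensus.StaticAnchor` BY NAME (rev 10 of
the route file), concluded by `StaticAnchor_of` from four named stubs.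

## The line (the route's own two-layer plan "StaticAnchor ⇐ NonRotatingIsStatic → StaticIsKerr",
## typed over the landed reduction `Theorems/SignedCensusStaticAnchor.lean`, p99144)

`StaticAnchor` is level `0` of the rotation-graded no-hair family: a REGULAR (globally hyperbolic
carrier, the embedded slice a Cauchy hypersurface) smooth stationary AF vacuum black hole `𝓑` with
connected non-degenerate future event horizon `𝓔⁺` (horizon Killing field quantified EXISTENTIALLY,
`IsNonDegenerateHorizon`), stationary field `T` normalised at infinity and CAUSAL on `𝓔⁺`
(`g(T,T) ≤ 0` there), has d.o.c. isometric to a subextremal Kerr exterior. The printed route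
(Chruściel–Costa–Heusler 2012 §3.3.1; Chruściel–Costa 2008 §7.2) is

  non-rotating `⇒` `T` hypersurface-orthogonal on `⟨⟨M_ext⟩⟩` (Sudarsky–Wald 1993 on the
  Chruściel–Wald maximal slice, bifurcate horizon attached by Rácz–Wald)
  `⇒` `⟨⟨M_ext⟩⟩` Schwarzschild (Chruściel–Costa 2008 Thm 1.4, analyticity removed by
  Chruściel–Galloway 2010) `⊂` Kerr exteriors (`a = 0 < M`),

and BOTH printed theorems consume Chruściel–Costa's `I⁺`-REGULARITY (CC08 Def. 1.1, tree predicate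
`StationaryAFBlackHole.IsIPlusRegular`, `Literature/Geometry/Lorentzian/IPlusRegular.lean`) together
with the non-rotating, non-degenerate clause ON `T` ITSELF (`T ≠ 0` and `∇_T T = κ T`, `κ ≠ 0`, on
`𝓔⁺`), whereas the route predicate offers global hyperbolicity of the CARRIER, the Cauchy property of
the slice, an existential horizon Killing field `K` and causality of `T` on `𝓔⁺`. Hence four stubs:

* `stub_sudarskyWaldStaticity` — the named Literature fact `SudarskyWald1993_staticity` (SW93
  Thms 1–2 / CW94 Thm 4.2 / RW96; printed for `I⁺`-regular vacuum holes in CC08 §7.2). A PUBLISHED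
  theorem, unproved in the tree; discharged either by a `_holds` theorem in Literature or — the
  tenure action the grounder and the prover both recommend — by re-filing the crux with
  `(h : SudarskyWald1993_staticity) →` as a hypothesis.
* `stub_docStaticUniqueness` — the named Literature fact `ChruscielGalloway2010_docStaticUniqueness`
  (CC08 Thm 1.4 as applied in §7.2; CG10 Thm 1.1 / Thm 4.1 = CCH12 Thm 3.1). Same status.
* `stub_iPlusRegularOfRegular` — BRIDGE B1 (the hardest, load-bearing stub): the route's regularity
  predicate at level `0` implies `I⁺`-regularity — the d.o.c. is a globally hyperbolic SET
  (Hawking–Ellis §6.6; causal convexity of `I⁺(M_ext) ∩ I⁻(M_ext)` inside the globally hyperbolic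
  carrier) AND it contains a Def-1.1 hypersurface `S ⊇ Σ_ext` whose closure is a manifold with
  boundary meeting every generator of `𝓔⁺` exactly once. NOT in print: Chruściel–Costa ASSUME (1.1)
  ("we have not been able to develop a coherent theory without assuming some version of (1.1)",
  CC08 p. 3); the natural candidate `range embed ∩ ⟨⟨M_ext⟩⟩` FAILS already for the Kruskal `T = 0`
  slice (its closure adds the bifurcation sphere, which is not in `𝓔⁺ ⊆ I⁺(M_ext)`), so `S` must be
  BUILT (bend the Cauchy slice to the future inside `⟨⟨M_ext⟩⟩` until it meets `𝓔⁺` transversally in a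
  compact cross-section — Chruściel–Wald 1994 §3–4 type constructions).
* `stub_nonRotatingWitness` — BRIDGE B2: under the same hypotheses the non-degeneracy witness may be
  taken to be `T` itself: `T ≠ 0` on `𝓔⁺` and `∇_T T = κ T` on `𝓔⁺` for ONE constant `κ ≠ 0`.
  Route to it: `T` causal and tangent to the null hypersurface `𝓔⁺` (tree:
  `StationaryAFBlackHole.mem_horizon_of_isMIntegralCurve`) `⇒ T ∥ K` on `𝓔⁺`; `T ≠ 0` on a compact
  cross-section by CC08 Cor. 3.3 GIVEN B1 (tree: `IPlusRegularHypersurface.killing_ne_zero_of_mem_boundarySet`)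
  and on all of `𝓔⁺` by the flow (CC08 Prop. 4.1); `κ_T` constant by the vacuum zeroth law on the
  connected Killing horizon (Rácz–Wald 1996; Heusler 1996 §6.3), `κ_T ≠ 0` from `κ_K ≠ 0`. So B2 is
  downstream of B1 plus printed structure theory; it is kept a separate stub because Sudarsky–Wald's
  tree statement consumes exactly this pair of clauses.

`StaticAnchor_of : StaticAnchor` (below; no hypotheses, the four stubs used as lemmas, no `sorry` of
its own) is the body of the landed curried composition `staticAnchor_of_bridge : stub₁-sig → … →
stub₄-sig → StaticAnchor` (p99144, re-checked as an `example`): for one `𝓑`, B2 gives the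
`T`-witness, B1 gives `I⁺`-regularity, and
`Theorems.SignedCensus.StaticAnchor.conclusion_of_isIPlusRegular_of_killing` (landed, sorry-free:
SW `→` staticity of the d.o.c. `→` CG `→` Schwarzschild `→` the route's unfolded Kerr conclusion with
`a = 0`, via `conclusion_of_isIsometricToSchwarzschildExterior`) concludes.

## Registrar's flags (for tenure / crux-plan, not acted on here)

1. Stubs 1–2 are PUBLISHED THEOREMS filed as named Literature facts: the crux as typed is "known in
   print modulo B1 ∧ B2" (grounder g39-22, prover p99144 `verdict: misstated`). The honest repair is at
   route level (re-file `StaticAnchor` with `(hSW : SudarskyWald1993_staticity) →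
   (hCG : ChruscielGalloway2010_docStaticUniqueness) →`, or add `𝓑.IsIPlusRegular →` to the graded
   predicate of all five decls = the prover's C′₂) — a `route edit`, outside this seat's remit.
2. B1 is where the crux can genuinely FAIL as typed: a globally hyperbolic stationary vacuum carrier
   whose Cauchy slice cannot be bent into a Def-1.1 hypersurface (pathological `𝓔⁺`: generators
   leaving every compact set of a would-be cross-section, or `S̄ ∖ S` not a topological surface).
   No such example is known with a CONNECTED NON-DEGENERATE `𝓔⁺`: Kruskal itself (two-ended slice)
   satisfies the predicate AND the conclusion, and the Weyl-ring, toroidal, geon and strut candidates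
   all violate global hyperbolicity or smoothness (prover evidence `evidence-StaticAnchor.md`,
   2026-08-16: Kruskal-piece classification).

Disproof used: none exists (`ledger crux ls stmt-FinalStateConjecture-10827`: no workfiles; no
`Theorems/StaticAnchor/Negative/`; negatives index of the summit has no statement about stationary
holes at level 0). Dead lines: none recorded for this crux.
-/

noncomputable section

-- D-0017: single-problem summit, `Summit.<S>.<S>.…` by design (cf. lakefile `weak.linter.dupNamespace`).
set_option linter.dupNamespace false

namespace Summit.FinalStateConjecture.FinalStateConjecture.Cruxes.StaticAnchor.Birth

open Set Function Filter Literature.Geometry.Lorentzian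
open scoped Manifold ContDiff Topology

/-! ## §1 The stubs -/

/-- **Stub 1 — the Sudarsky–Wald staticity theorem** (named Literature fact, unproved in the tree):
an `I⁺`-regular vacuum stationary AF black hole with non-empty `𝓔⁺` on which `T ≠ 0` and
`∇_T T = κ T`, `κ ≠ 0`, has `T` hypersurface-orthogonal on `⟨⟨M_ext⟩⟩`. Sudarsky–Wald, Phys. Rev.
D 47 (1993) R5209, Thms 1–2, on the maximal slice of Chruściel–Wald, CMP 163 (1994) 561, Thm 4.2,
bifurcate horizon by Rácz–Wald, CQG 13 (1996) 539; printed for `I⁺`-regular vacuum holes in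
Chruściel–Costa arXiv:0806.0016 §7.2 and Chruściel–Costa–Heusler arXiv:1205.6112 §3.3.1. A published
theorem: to be consumed as the hypothesis `(h : SudarskyWald1993_staticity)` once the crux is
re-filed in fact-conditional form, not re-proved here. -/
theorem stub_sudarskyWaldStaticity : Literature.Geometry.Lorentzian.SudarskyWald1993_staticity := by
  sorry

/-- **Stub 2 — static vacuum uniqueness for a static d.o.c., without analyticity** (named
Literature fact, unproved in the tree): an `I⁺`-regular vacuum stationary AF black hole whose
stationary field is hypersurface-orthogonal on `⟨⟨M_ext⟩⟩`, with `𝓔⁺ ≠ ∅`, has `⟨⟨M_ext⟩⟩`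
isometric to a Schwarzschild exterior of positive mass. Chruściel–Costa arXiv:0806.0016 Thm 1.4 as
applied in §7.2; analyticity removed by Chruściel–Galloway arXiv:1004.0513 Thm 1.1 / Thm 4.1
(= Chruściel–Costa–Heusler arXiv:1205.6112 Thm 3.1). Same status as stub 1. -/
theorem stub_docStaticUniqueness : Literature.Geometry.Lorentzian.ChruscielGalloway2010_docStaticUniqueness := by
  sorry

/-- **Stub 3 — bridge B1, `I⁺`-regularity of regular non-rotating holes (load-bearing).** A smooth
stationary AF black hole (`StationaryAFBlackHole`) whose carrier is globally hyperbolic with the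
embedded slice a Cauchy hypersurface, whose future event horizon is connected and non-degenerate
(`IsNonDegenerateHorizon`, horizon Killing field existential), with `T` normalised at infinity and
causal on `𝓔⁺`, vacuum, is `I⁺`-regular in the sense of Chruściel–Costa 2008, Def. 1.1
(`StationaryAFBlackHole.IsIPlusRegular`: `T` complete; `⟨⟨M_ext⟩⟩` a globally hyperbolic set; a
spacelike connected acausal hypersurface `S ⊇ Σ_ext` in `⟨⟨M_ext⟩⟩` with `S̄` a topological manifold
with boundary, compact modulo finitely many AF ends, `∂S̄ ⊆ 𝓔⁺` meeting every generator of `𝓔⁺`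
exactly once). Not in print (Chruściel–Costa arXiv:0806.0016 p. 3 ASSUME their (1.1)); why it might
fail: the Cauchy slice of the carrier meets `∂⟨⟨M_ext⟩⟩` at the bifurcation set, not on `𝓔⁺`
(Kruskal), so `S` must be constructed, and a pathological connected non-degenerate `𝓔⁺` whose
generators admit no compact topological cross-section inside a bent slice would defeat it.
Sources: ChruscielCosta2008 Def. 1.1, §4; ChruscielWald1994 §3–4; FriedrichRaczWald1999. -/
theorem stub_iPlusRegularOfRegular : ∀ (𝓑 : Literature.Geometry.Lorentzian.StationaryAFBlackHole.{0}) [𝓑.metric.HasLeviCivita], 𝓑.metric.isOpen_chronologicalFuture 𝓑.timeOrientation → 𝓑.metric.isOpen_chronologicalPast 𝓑.timeOrientation → 𝓑.metric.IsGloballyHyperbolic 𝓑.timeOrientation → 𝓑.metric.IsCauchyHypersurface 𝓑.timeOrientation (Set.range 𝓑.embed) → IsConnected 𝓑.horizon → 𝓑.toSpacetime.IsNonDegenerateHorizon 𝓑.Mext → Filter.Tendsto (fun x ↦ 𝓑.metric.val (𝓑.embed x) (𝓑.killing (𝓑.embed x)) (𝓑.killing (𝓑.embed x))) (⨅ R :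 ℝ, Filter.principal (𝓑.e.far R)) (nhds (-1)) → (∀ p ∈ 𝓑.horizon, 𝓑.metric.val p (𝓑.killing p) (𝓑.killing p) ≤ 0) → 𝓑.metric.toPseudoRiemannianMetric.IsRicciFlat → 𝓑.IsIPlusRegular := by
  sorry

/-- **Stub 4 — bridge B2, the non-rotating witness on `𝓔⁺`.** Under the same hypotheses the
stationary Killing field `T` itself witnesses the non-degenerate horizon: `T` has no zeros on `𝓔⁺`
and `∇_T T = κ T` on `𝓔⁺` for ONE constant `κ ≠ 0` (so `𝓔⁺` is a non-rotating, non-degenerate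
Killing horizon of `T`: by the Killing equation `κ g(T,T) = g(∇_T T, T) = 0`, `T` is null there).
Route: `T` is tangent to `𝓔⁺` (tree: `StationaryAFBlackHole.mem_horizon_of_isMIntegralCurve`) and
causal there, hence parallel to the null generator `K`; no zeros on a compact cross-section by
Chruściel–Costa 2008 Cor. 3.3 given B1 (tree: `IPlusRegularHypersurface.killing_ne_zero_of_mem_boundarySet`),
on all of `𝓔⁺` by the flow (CC08 Prop. 4.1); `κ` constant by the vacuum zeroth law on the connected
horizon (Rácz–Wald 1996; Heusler 1996 §6.3) and non-zero from the non-degeneracy of `K`. Why it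
might fail: a priori `T = f K` on `𝓔⁺` with `f` non-constant and `K(f) + κ_K f` not constant, or `f`
vanishing on a cross-section not met by any Def-1.1 hypersurface; the zeroth law needs `𝓔⁺` at
least `C²`, which for a merely Lipschitz achronal boundary is Chruściel–Costa 2008 Thm 4.11 under
`I⁺`-regularity again. Sources: ChruscielCosta2008 §2.3 (2.8), Cor. 3.3, Prop. 4.1, Thm 4.11, §7.2;
RaczWald1996; Heusler1996 §6.3. -/
theorem stub_nonRotatingWitness : ∀ (𝓑 : Literature.Geometry.Lorentzian.StationaryAFBlackHole.{0}) [𝓑.metric.HasLeviCivita], 𝓑.metric.isOpen_chronologicalFuture 𝓑.timeOrientation → 𝓑.metric.isOpen_chronologicalPast 𝓑.timeOrientation → 𝓑.metric.IsGloballyHyperbolic 𝓑.timeOrientation → 𝓑.metric.IsCauchyHypersurface 𝓑.timeOrientation (Set.range 𝓑.embed) → IsConnected 𝓑.horizon → 𝓑.toSpacetime.IsNonDegenerateHorizon 𝓑.Mext → Filter.Tendsto (fun x ↦ 𝓑.metric.val (𝓑.embed x) (𝓑.killing (𝓑.embed x)) (𝓑.killing (𝓑.embed x))) (⨅ R : ℝ,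 Filter.principal (𝓑.e.far R)) (nhds (-1)) → (∀ p ∈ 𝓑.horizon, 𝓑.metric.val p (𝓑.killing p) (𝓑.killing p) ≤ 0) → 𝓑.metric.toPseudoRiemannianMetric.IsRicciFlat → (∀ p ∈ 𝓑.horizon, 𝓑.killing p ≠ 0) ∧ ∃ κ : ℝ, κ ≠ 0 ∧ ∀ p ∈ 𝓑.horizon, 𝓑.metric.leviCivita 𝓑.killing p (𝓑.killing p) = κ • 𝓑.killing p := by
  sorry

/-! ## §2 The composition (sorry-free): stubs 1–4 ⟹ the route decl, by name -/

/-- **`StaticAnchor` from the four stubs** (the registered skeleton theorem: concludes the route decl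
`Theses.SignedCensus.StaticAnchor` BY NAME, takes no hypotheses, and every `sorry` it depends on sits
inside a declared `stub_*`). For one black hole `𝓑` satisfying the route predicate at level `0`:
stub 4 (B2) supplies the `T`-witness (`T ≠ 0`, `∇_T T = κ T`, `κ ≠ 0` on `𝓔⁺`), stub 3 (B1)
supplies `I⁺`-regularity, `𝓔⁺ ≠ ∅` by connectedness, and the landed
`Theorems.SignedCensus.StaticAnchor.conclusion_of_isIPlusRegular_of_killing` (p99144, sorry-free)
runs Sudarsky–Wald (stub 1: staticity of `⟨⟨M_ext⟩⟩`) and Chruściel–Galloway (stub 2: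
Schwarzschild) and rewrites the Schwarzschild isometry as the route's unfolded subextremal-Kerr
conclusion (`a = 0 < M`, `conclusion_of_isIsometricToSchwarzschildExterior`). This is verbatim the
body of the landed curried composition `staticAnchor_of_bridge : stub₁-sig → stub₂-sig → stub₃-sig →
stub₄-sig → StaticAnchor` (re-checked as the `example` below). Chruściel–Costa–Heusler 2012 §3.3.1;
Chruściel–Costa 2008 §7.2. -/
theorem StaticAnchor_of :
    Summit.FinalStateConjecture.FinalStateConjecture.Theses.SignedCensus.StaticAnchor := by
  intro 𝓑 _ _ hF hP hgh hcs hconn hnd hfar hlev hvac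
  obtain ⟨hT, hκ⟩ := stub_nonRotatingWitness 𝓑 hF hP hgh hcs hconn hnd hfar hlev hvac
  exact Summit.FinalStateConjecture.FinalStateConjecture.Theorems.SignedCensus.StaticAnchor.conclusion_of_isIPlusRegular_of_killing
    stub_sudarskyWaldStaticity stub_docStaticUniqueness 𝓑 hF hP
    (stub_iPlusRegularOfRegular 𝓑 hF hP hgh hcs hconn hnd hfar hlev hvac) hvac hconn.nonempty hT hκ

/-- **The curried reading of BC3** — `stub₁-sig → stub₂-sig → stub₃-sig → stub₄-sig → StaticAnchor`,
kernel-checked and sorry-free: it is the landed `staticAnchor_of_bridge` (p99144). Stated as an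
`example` (no second named theorem concluding the crux, so the skeleton audit reads `StaticAnchor_of`
above); the four hypothesis types are, token for token, the signatures of stubs 1–4. -/
example :
    Literature.Geometry.Lorentzian.SudarskyWald1993_staticity →
    Literature.Geometry.Lorentzian.ChruscielGalloway2010_docStaticUniqueness →
    (∀ (𝓑 : Literature.Geometry.Lorentzian.StationaryAFBlackHole.{0}) [𝓑.metric.HasLeviCivita], 𝓑.metric.isOpen_chronologicalFuture 𝓑.timeOrientation → 𝓑.metric.isOpen_chronologicalPast 𝓑.timeOrientation → 𝓑.metric.IsGloballyHyperbolic 𝓑.timeOrientation → 𝓑.metric.IsCauchyHypersurface 𝓑.timeOrientation (Set.range 𝓑.embed) → IsConnected 𝓑.horizon → 𝓑.toSpacetime.IsNonDegenerateHorizon 𝓑.Mext → Filter.Tendsto (fun x ↦ 𝓑.metric.val (𝓑.embed x) (𝓑.killing (𝓑.embed x)) (𝓑.killing (𝓑.embed x))) (⨅ R : ℝ, Filter.principal (𝓑.e.far R)) (nhds (-1)) → (∀ p ∈ 𝓑.horizon, 𝓑.metric.val p (𝓑.killing p) (𝓑.killing p) ≤ 0) → 𝓑.metric.toPseudoRiemannianMetric.IsRicciFlat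 → 𝓑.IsIPlusRegular) →
    (∀ (𝓑 : Literature.Geometry.Lorentzian.StationaryAFBlackHole.{0}) [𝓑.metric.HasLeviCivita], 𝓑.metric.isOpen_chronologicalFuture 𝓑.timeOrientation → 𝓑.metric.isOpen_chronologicalPast 𝓑.timeOrientation → 𝓑.metric.IsGloballyHyperbolic 𝓑.timeOrientation → 𝓑.metric.IsCauchyHypersurface 𝓑.timeOrientation (Set.range 𝓑.embed) → IsConnected 𝓑.horizon → 𝓑.toSpacetime.IsNonDegenerateHorizon 𝓑.Mext → Filter.Tendsto (fun x ↦ 𝓑.metric.val (𝓑.embed x) (𝓑.killing (𝓑.embed x)) (𝓑.killing (𝓑.embed x))) (⨅ R : ℝ, Filter.principal (𝓑.e.far R)) (nhds (-1)) → (∀ p ∈ 𝓑.horizon, 𝓑.metric.val p (𝓑.killing p) (𝓑.killing p) ≤ 0) → 𝓑.metric.toPseudoRiemannianMetric.IsRicciFlat → (∀ p ∈ 𝓑.horizon, 𝓑.killing p ≠ 0) ∧ ∃ κ : ℝ, κ ≠ 0 ∧ ∀ p ∈ 𝓑.horizon, 𝓑.metric.leviCivita 𝓑.killing p (𝓑.killing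 p) = κ • 𝓑.killing p) →
    Summit.FinalStateConjecture.FinalStateConjecture.Theses.SignedCensus.StaticAnchor :=
  Summit.FinalStateConjecture.FinalStateConjecture.Theorems.SignedCensus.StaticAnchor.staticAnchor_of_bridge

end Summit.FinalStateConjecture.FinalStateConjecture.Cruxes.StaticAnchor.Birth

end
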